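import Summits.Ventures.HSemireg.Pad4TowerLinePhaseRigidityTags

/-!
# Pad4Tower ∕ LinePhaseRigidity — Part H TOP PAIRS HAVE THE SAME PARITY (h-uniform, PROVED; uses the shift symmetry `Δ`) and Part I NO ODD FC BELOW TEN (PROVED h-uniformly; `oddFCFreeLine_of_lt_ten`) with the UNIT NUCLEUS left at `h = 10`
# (HSemireg support file; PT-PORT-2 (a3), tree copy of control's crux workfile)

Crux of record: `Summit.HodgeConjecture.HodgeConjecture.Theses.EightfoldBlochSeeds.BlochSeedDiscOne` (= `HasHyperbolicBlochSeed 4 1`, item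
stmt-HodgeConjecture-18881; skeleton `Cruxes/BlochSeedDiscOne/Lines/birth.lean` 814a6a70c14e831a, STUB R `stub_rung_pad4_seedAt`, UNTOUCHED).
Nothing in this file proves HC, HC_AV, HC_CM, H2, item 18881, (T₈) or (T₁₀); census-neutral (no SAT∕UNSAT row is added or changed). Statements about
the typed FIRST-ORDER static game on the LINE alphabet of the PAD-4 design tower (`RuleDMu4Closed`, `XPlusClosed`, `G1Closed` of record) — H₁-static
letter DESIGNS, not sheaves, monads or seeds; HC_CM is a displayed binder of the ladder only, unused here.

PROVENANCE. TREE COPY — statements AND proofs verbatim; new are only the namespace `Summit.Ventures.HSemireg.Pad4Tower.LinePhaseRigidity`, this module docstring, the module boundary, the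
`open` of the tree toolkit namespace `…Pad4Tower.LineInertia` (= the workfile's Part A), one-line docstrings where the gate requires them, and TWO dedups
to the tree (the one the key allows: Part J's `fin4_add_two_ne : ∀ k : Fin 4, k + 2 ≠ k` is NOT re-declared — its uses call the toolkit's identical `LineInertia.add_two_ne` —
and, of the same kind, the workfile's alias `fin4_third := exists_third` is NOT re-declared: its two uses call (a2)'s identical tree lemma `LinePhaseRigidity.exists_third`
(`Pad4TowerLinePhaseRigidityUnits`), which the gate flags as a same-tree near-duplicate otherwise) of Parts H and I of the crux workfile `Cruxes/BlochSeedDiscOne/LinePhaseRigidity.lean` v1.9 (author plan-lens-HodgeAV-control g9; crux commit f5c30e1c3066, sha16 f0ad6d2122a71d9c; critic plates idea-crit-6 g15 PASS). Filed in the tree on plan-lens-HodgeAV-control g10's KEY (a3) (bus l.10147: «Parts G–L up to `oddFCFreeLine_of_lt_twelve`,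
`not_oddFCFreeLine_twelve`, `fcShapeLine_of_lt_twelve` → tree, so that `DiamondLevelLaws.OddLineFree h` (∀ h < 12) is a tree theorem and the displayed
hypothesis of `oddThreshold_iff_lineNest` is discharged by name» — control's wording; `DiamondLevelLaws.OddLineFree` ∕ `oddThreshold_iff_lineNest` are declarations of the
crux workfile `Cruxes/BlochSeedDiscOne/DiamondLevelLaws.lean`, NOT of this chain) by hsemireg-phasetorus-typer-1 g3 (v3 docstring∕dedup hygiene by typer-1 g5). Module set of (a3), each importing the previous, on top of
(a2)'s `Pad4TowerLinePhaseRigidityGap`: `Pad4TowerLinePhaseRigidityTags` (Part G) → `…Parity` (Parts H, I) → `…Nucleus1` (Part J, first half) → `…Nucleus2` (Part J, second half: `oddFCFreeLine_of_lt_twelve`, `oddLineThresholdLaw_holds`) → `…PhaseType` (Part K) → `…Shape` (Part L: `fcShapeLine_of_lt_twelve`). 0 sorry, 0 named facts, no instance ∕ notation ∕ set_option ∕ native_decide; docstring on every declaration.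

CONTENT. Part H (`namespace LineModel`): parity of top pairs via `shiftN∕shiftP`. Part I: `AbstractOddUnitNucleusFree`, `abstractOddFree_of_unitNucleus`, **`oddFCFreeLine_of_lt_ten`** and the unit-nucleus reduction at `h = 10`.
-/

namespace Summit.Ventures.HSemireg.Pad4Tower.LinePhaseRigidity

open Finset Summit.Ventures.HSemireg.Pad4Tower Summit.Ventures.HSemireg.LinePhaseTorus Summit.Ventures.HSemireg.Pad4Tower.LineInertia

/-! ## Part H — TOP PAIRS HAVE THE SAME PARITY (h-uniform, PROVED; uses the shift symmetry `Δ`)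

`tag_unique` + one slot swap + a tag shift: two letters OF EQUAL CHARGE `c` sitting at the top admissible level of their census —
`2(c+2) > h` on `P` (sub-ceiling), `2(c+3) > h` on `N` — have tags that are EQUAL or ANTIPODAL (`p_top_pair_parity`,
`n_top_pair_parity`): the first phase-sensitive law among cells with only two charged letters, and the `PAIRPROBE-h12.txt` pattern
«`P(5,5)` ∕ `N(4,4)` adjacent absent, equal∕antipodal present» for every `h`.  It is the top-of-the-alphabet twin of the unit-level
antipodal law `unit_pair_antipodal` of Part B. -/

/-- `fin4_two_mul_eq_zero` (Parts H–I; tree copy, statement verbatim). -/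
theorem fin4_two_mul_eq_zero : ∀ t : Fin 4, t + t = 0 → t = 0 ∨ t = 2 := by decide

namespace LineModel

variable {h : ℤ} {vN vP : ACell → Prop}

/-- `P`-presence only depends on the cell up to the tags of its apex letters. -/
theorem congrP (M : LineModel h vN vP) {X Y : ACell} (hX : vP X) (hXY : ∀ i, X i = Y i ∨ ((X i).1 = 0 ∧ (Y i).1 = 0)) : vP Y := by
  have step : ∀ (Z : ACell) (i : Fin 4), vP Z → (Z i = Y i ∨ ((Z i).1 = 0 ∧ (Y i).1 = 0)) → vP (Function.update Z i (Y i)) := by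
    intro Z i hZ hi
    rcases hi with e | ⟨hz, hy⟩
    · rw [← e, Function.update_eq_self]; exact hZ
    · have : Y i = (0, (Y i).2) := Prod.ext hy rfl
      rw [this]; exact M.apexP Z hZ i _ hz
  have h0 := step X 0 hX (hXY 0)
  have h1 := step _ 1 h0 (by rw [Function.update_of_ne (by decide)]; exact hXY 1)
  have h2 := step _ 2 h1 (by rw [Function.update_of_ne (by decide), Function.update_of_ne (by decide)]; exact hXY 2)
  have h3 := step _ 3 h2 (by
    rw [Function.update_of_ne (by decide), Function.update_of_ne (by decide), Function.update_of_ne (by decide)]; exact hXY 3)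
  have e : Function.update (Function.update (Function.update (Function.update X 0 (Y 0)) 1 (Y 1)) 2 (Y 2)) 3 (Y 3) = Y := by
    funext i; fin_cases i <;> simp
  rwa [e] at h3

/-- `N`-presence only depends on the cell up to the tags of its apex letters. -/
theorem congrN (M : LineModel h vN vP) {X Y : ACell} (hX : vN X) (hXY : ∀ i, X i = Y i ∨ ((X i).1 = 0 ∧ (Y i).1 = 0)) : vN Y := by
  have step : ∀ (Z : ACell) (i : Fin 4), vN Z → (Z i = Y i ∨ ((Z i).1 = 0 ∧ (Y i).1 = 0)) → vN (Function.update Z i (Y i)) := by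
    intro Z i hZ hi
    rcases hi with e | ⟨hz, hy⟩
    · rw [← e, Function.update_eq_self]; exact hZ
    · have : Y i = (0, (Y i).2) := Prod.ext hy rfl
      rw [this]; exact M.apexN Z hZ i _ hz
  have h0 := step X 0 hX (hXY 0)
  have h1 := step _ 1 h0 (by rw [Function.update_of_ne (by decide)]; exact hXY 1)
  have h2 := step _ 2 h1 (by rw [Function.update_of_ne (by decide), Function.update_of_ne (by decide)]; exact hXY 2)
  have h3 := step _ 3 h2 (by
    rw [Function.update_of_ne (by decide), Function.update_of_ne (by decide), Function.update_of_ne (by decide)]; exact hXY 3)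
  have e : Function.update (Function.update (Function.update (Function.update X 0 (Y 0)) 1 (Y 1)) 2 (Y 2)) 3 (Y 3) = Y := by
    funext i; fin_cases i <;> simp
  rwa [e] at h3

/-- the tag shift by any amount (`Δ` iterated). -/
theorem shiftP_by (M : LineModel h vN vP) {X : ACell} (hX : vP X) (s : Fin 4) : vP (fun i => ((X i).1, (X i).2 + s)) := by
  have h1 := M.shiftP _ hX
  have h2 := M.shiftP _ h1
  have h3 := M.shiftP _ h2
  have h4 := M.shiftP _ h3
  have e1 : X.shift = fun i => ((X i).1, (X i).2 + 3) := rfl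
  have e2 : X.shift.shift = fun i => ((X i).1, (X i).2 + 2) := by
    funext i; simp only [ACell.shift]; refine Prod.ext rfl ?_; show (X i).2 + 3 + 3 = (X i).2 + 2
    have : ∀ k : Fin 4, k + 3 + 3 = k + 2 := by decide
    exact this _
  have e3 : X.shift.shift.shift = fun i => ((X i).1, (X i).2 + 1) := by
    funext i; simp only [ACell.shift]; refine Prod.ext rfl ?_; show (X i).2 + 3 + 3 + 3 = (X i).2 + 1
    have : ∀ k : Fin 4, k + 3 + 3 + 3 = k + 1 := by decide
    exact this _
  have e4 : X.shift.shift.shift.shift = fun i => ((X i).1, (X i).2 + 0) := by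
    funext i; simp only [ACell.shift]; refine Prod.ext rfl ?_; show (X i).2 + 3 + 3 + 3 + 3 = (X i).2 + 0
    have : ∀ k : Fin 4, k + 3 + 3 + 3 + 3 = k + 0 := by decide
    exact this _
  fin_cases s
  · rw [e4] at h4; exact h4
  · rw [e3] at h3; exact h3
  · rw [e2] at h2; exact h2
  · rw [e1] at h1; exact h1

/-- **TOP PAIR PARITY on `P` (PROVED, h-uniform)**: two sub-ceiling letters (`2(c+2) > h`) of equal charge in one `P`-cell (the other two
slots apex) have equal or antipodal tags.  Swap the two slots and shift the tags by `t = k_b − k_g`: the new cell has the same `b`-letter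
and `g`-tag `k_g + 2t`, so `tag_unique` at the rigid `b`-letter forces `2t = 0`. -/
theorem p_top_pair_parity (M : LineModel h vN vP) {X : ACell} (hX : vP X) {g b : Fin 4} (hgb : g ≠ b) (hc : (X b).1 = (X g).1)
    (hg : 1 ≤ (X g).1) (hrig : h < 2 * ((X g).1 : ℤ) + 4) (hapex : ∀ i, i ≠ g → i ≠ b → (X i).1 = 0) :
    (X b).2 = (X g).2 ∨ (X b).2 = (X g).2 + 2 := by
  obtain ⟨f, hfg, hfb⟩ := exists_third g b
  set t : Fin 4 := (X b).2 - (X g).2 with ht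
  have hk' : (X b).2 = (X g).2 + t := by rw [ht]; abel
  -- the swapped and shifted cell, normalised to the apex tags of `X`
  have hS := M.shiftP_by (M.permP X hX (Equiv.swap g b)) t
  have hq : vP (Function.update X g ((X g).1, (X b).2 + t)) := by
    refine M.congrP hS (fun i => ?_)
    by_cases hig : i = g
    · subst hig
      left
      rw [Function.update_self, Equiv.swap_apply_left, hc]
    · by_cases hib : i = b
      · subst hib
        left
        rw [Function.update_of_ne hig, Equiv.swap_apply_right]
        exact Prod.ext hc.symm hk'.symm
      · right
        simp only [Equiv.swap_apply_of_ne_of_ne hig hib, Function.update_of_ne hig]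
        exact ⟨hapex i hig hib, hapex i hig hib⟩
  have hp : vP (Function.update X g ((X g).1, (X g).2)) := by
    rw [show ((X g).1, (X g).2) = X g from rfl, Function.update_eq_self]; exact hX
  have key := M.tag_unique (X := X) (g := b) (b := g) (f := f) hgb.symm hfg (by rw [hc]; exact hg) (by rw [hc]; exact hrig)
    (hapex f hfg hfb) hg hg hp hq
  -- key : (X g).2 = (X b).2 + t = (X g).2 + t + t
  rw [hk', add_assoc] at key
  have htt : t + t = 0 := by
    have := congrArg (fun x => x - (X g).2) key
    simp at this
    exact this.symm
  rcases fin4_two_mul_eq_zero t htt with h0 | h2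
  · left; rw [hk', h0, add_zero]
  · right; rw [hk', h2]

/-- **TOP PAIR PARITY on `N` (PROVED, h-uniform)**: two letters of equal charge `c` with `2(c+3) > h` in one `N`-cell (other slots apex)
have equal or antipodal tags.  RD-N2 raises either letter by exactly one level (to a rigid letter); swapping and shifting the second
raised cell by `−t` reproduces the rigid letter of the first with `b`-tag `k_g − t` against `k_g + t`, and `tag_unique` gives `2t = 0`. -/
theorem n_top_pair_parity (M : LineModel h vN vP) {X : ACell} (hX : vN X) {g b : Fin 4} (hgb : g ≠ b) (hc : (X b).1 = (X g).1)
    (hg : 1 ≤ (X g).1) (htop : h < 2 * ((X g).1 : ℤ) + 6) (hapex : ∀ i, i ≠ g → i ≠ b → (X i).1 = 0) :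
    (X b).2 = (X g).2 ∨ (X b).2 = (X g).2 + 2 := by
  obtain ⟨f, hfg, hfb⟩ := exists_third g b
  set t : Fin 4 := (X b).2 - (X g).2 with ht
  have hk' : (X b).2 = (X g).2 + t := by rw [ht]; abel
  have hb : 1 ≤ (X b).1 := by rw [hc]; exact hg
  -- RD-N2 raises a letter of the pair by exactly one level
  have raise : ∀ {x y : Fin 4}, x ≠ y → 1 ≤ (X x).1 → 1 ≤ (X y).1 → h < 2 * ((X x).1 : ℤ) + 6 →
      vP (Function.update X x ((X x).1 + 1, (X x).2)) := by
    intro x y hxy hx hy hxtop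
    obtain ⟨c', hc', hch, hP⟩ := M.rdN2 X hX x y hxy hx hy
    have hc'eq : c' = (X x).1 + 1 := by
      by_contra hne
      have h2 : (X x).1 + 2 ≤ c' := by omega
      have e1 : Function.update X x (c', (X x).2) x = (c', (X x).2) := Function.update_self _ _ _
      have e2 : Function.update X x (c', (X x).2) y = X y := Function.update_of_ne hxy.symm _ _
      refine M.p_ceiling_absent hP (g := x) (b := y) hxy (by rw [e1]; omega) (by rw [e2]; exact hy) ?_
      rw [e1]
      have : ((X x).1 : ℤ) + 2 ≤ c' := by exact_mod_cast h2
      push_cast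
      linarith
    rw [hc'eq] at hP
    exact hP
  have hY1 := raise hgb hg hb htop
  have hY2 := raise hgb.symm hb hg (by rw [hc]; exact htop)
  -- swap and shift the second raised cell by `−t`, normalise apex tags
  have hS := M.shiftP_by (M.permP _ hY2 (Equiv.swap g b)) (-t)
  set X₀ : ACell := Function.update X g ((X g).1 + 1, (X g).2) with hX₀
  have hq : vP (Function.update X₀ b ((X b).1, (X g).2 - t)) := by
    refine M.congrP hS (fun i => ?_)
    by_cases hig : i = g
    · subst hig
      left
      rw [Function.update_of_ne hgb, hX₀, Function.update_self, Equiv.swap_apply_left, Function.update_self, hc]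
      refine Prod.ext rfl ?_
      show (X b).2 + -t = (X i).2
      rw [hk']; abel
    · by_cases hib : i = b
      · subst hib
        left
        rw [Function.update_self, Equiv.swap_apply_right, Function.update_of_ne hgb]
        refine Prod.ext hc.symm ?_
        show (X g).2 + -t = (X g).2 - t
        abel
      · right
        simp only [Equiv.swap_apply_of_ne_of_ne hig hib, Function.update_of_ne hib, Function.update_of_ne hig, hX₀]
        exact ⟨hapex i hig hib, hapex i hig hib⟩
  have hp : vP (Function.update X₀ b ((X b).1, (X g).2 + t)) := by
    have : ((X b).1, (X g).2 + t) = X₀ b := by rw [hX₀, Function.update_of_ne hgb.symm, ← hk']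
    rw [this, Function.update_eq_self]; exact hY1
  have e0g : X₀ g = ((X g).1 + 1, (X g).2) := by rw [hX₀, Function.update_self]
  have e0f : (X₀ f).1 = 0 := by rw [hX₀, Function.update_of_ne hfg]; exact hapex f hfg hfb
  have key := M.tag_unique (X := X₀) (g := g) (b := b) (f := f) hgb hfb (by rw [e0g]; omega)
    (by rw [e0g]; push_cast; linarith) e0f hb hb hp hq
  -- key : (X g).2 + t = (X g).2 - t
  have htt : t + t = 0 := by
    have := congrArg (fun x => x - (X g).2 + t) key
    simp at this
    exact this
  rcases fin4_two_mul_eq_zero t htt with h0 | h2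
  · left; rw [hk', h0, add_zero]
  · right; rw [hk', h2]

end LineModel

/-- design form of `p_top_pair_parity`: two sub-ceiling line letters of one charge `c` (`2(c+2) > h`) in a RULE-D `P`-cell of a
`G₁`-closed RULE-D∕`X+` LINE design, the other two slots at the apex, have tags of the same parity. -/
theorem top_pair_parity_P {h : ℤ} {C : MConfig} (hC : LSupport h C) (hG : C.G1Closed) (hD : RuleDMu4Closed C) (hX : XPlusClosed C)
    {P : MCell} (hP : P ∈ C.upper) {g b : Fin 4} (hgb : g ≠ b) {c : ℕ} {k k' : Fin 4} (hc : 1 ≤ c) (hrig : h < 2 * (c : ℤ) + 4)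
    (eg : P g = lineLetter h c k) (eb : P b = lineLetter h c k') (hapex : ∀ i, i ≠ g → i ≠ b → P i = (h, 0, 0)) :
    k' = k ∨ k' = k + 2 := by
  have hM := lineModel_of_config hC hG hD hX
  obtain ⟨X, rfl⟩ := exists_realize (fun f => hC.2 _ hP f)
  rw [realize_apply] at eg eb
  have hcg := charge_eq_of_lineLetter_eq eg
  have hcb := charge_eq_of_lineLetter_eq eb
  obtain ⟨-, rfl⟩ := lineLetter_inj (by rw [hcg]; exact hc) eg
  obtain ⟨-, rfl⟩ := lineLetter_inj (by rw [hcb]; exact hc) eb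
  have hap : ∀ i, i ≠ g → i ≠ b → (X i).1 = 0 := by
    intro i hig hib
    have e := congrArg Prod.fst (hapex i hig hib)
    rw [realize_apply, lineLetter_fst] at e
    simp at e
    exact e
  exact hM.p_top_pair_parity hP hgb (by rw [hcb, hcg]) (by rw [hcg]; exact hc) (by rw [hcg]; exact hrig) hap

/-! ## Part I — NO ODD FC BELOW TEN (PROVED h-uniformly) and the UNIT NUCLEUS that is left at `h = 10`

Corollaries of the three-equal-tags laws of Part G.  On `N`: for `h < 12` EVERY letter of a fully charged `N`-cell has `2(c+5) > h`,
so all four tags coincide (`fcN_tags_const`) and the cell is not odd — **no odd FC `N`-cell below twelve** (`no_oddN_below_twelve`).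
On `P`: for `h < 10` a fully charged `P`-cell is a unit cell (`fcP_gap_three`), RD-P lands on the apex, and `n3_tags` (`2(1+4) > h`)
makes every three of its tags equal — **no odd FC `P`-cell below ten**; hence `AbstractOddFree h` and **`OddFCFreeLine h` for every
`h < 10` (`oddFCFreeLine_of_lt_ten`)**: the `(OL₈)`∕`(OL₉)` rows of the census are now KERNEL theorems, uniformly in `h`.  For
`h < 12` an odd FC `P`-cell is either a UNIT cell or has exactly one charge-2 letter with the other three (unit) letters equally tagged
(`oddP_shape_below_twelve`); so the one remaining machine fact `AbstractOddFree 10` is equivalent to the absence of this UNIT NUCLEUS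
(`AbstractOddUnitNucleusFree 10`, `oddLineThresholdLaw_of_unitNucleus`). -/

namespace LineModel

variable {h : ℤ} {vN vP : ACell → Prop}

/-- below twelve all four tags of a fully charged `N`-cell coincide. -/
theorem fcN_tags_const (M : LineModel h vN vP) {X : ACell} (hX : vN X) (hc : ∀ f, 1 ≤ (X f).1) (hh : h < 12) (a b : Fin 4) :
    (X a).2 = (X b).2 := by
  by_cases hab : a = b
  · rw [hab]
  obtain ⟨g, hga, hgb⟩ := exists_third a b
  have := hc g
  exact M.fcN_three_tags hX hc hga hgb hab (by omega)

/-- **no odd fully charged `N`-cell below twelve** (PROVED, h-uniform). -/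
theorem no_oddN_below_twelve (M : LineModel h vN vP) (hh : h < 12) {X : ACell} (hodd : AOddFC X) : ¬ vN X := by
  intro hX
  obtain ⟨hc, hpar⟩ := hodd
  have e1 := M.fcN_tags_const hX hc hh 1 0
  have e2 := M.fcN_tags_const hX hc hh 2 0
  have e3 := M.fcN_tags_const hX hc hh 3 0
  rw [e1, e2, e3] at hpar
  omega

/-- below ten a fully charged `P`-cell is a unit cell. -/
theorem fcP_unit_below_ten (M : LineModel h vN vP) (hh : h < 10) {X : ACell} (hX : vP X) (hc : ∀ f, 1 ≤ (X f).1) (f : Fin 4) :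
    (X f).1 = 1 := by
  have := M.fcP_gap_three hX hc f
  have := hc f
  omega

/-- below ten all four tags of a fully charged `P`-cell coincide. -/
theorem fcP_tags_const_below_ten (M : LineModel h vN vP) (hh : h < 10) {X : ACell} (hX : vP X) (hc : ∀ f, 1 ≤ (X f).1)
    (a b : Fin 4) : (X a).2 = (X b).2 := by
  by_cases hab : a = b
  · rw [hab]
  obtain ⟨g, hga, hgb⟩ := exists_third a b
  obtain ⟨f, hgf, haf, hbf⟩ := fin4_fourth hga hgb hab
  obtain ⟨c', hc', hN⟩ := M.rdP X hX f (hc f)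
  have hc0 : c' = 0 := by have := M.fcP_unit_below_ten hh hX hc f; omega
  subst hc0
  have eg : Function.update X f ((0 : ℕ), (X f).2) g = X g := Function.update_of_ne hgf _ _
  have ea : Function.update X f ((0 : ℕ), (X f).2) a = X a := Function.update_of_ne haf _ _
  have eb : Function.update X f ((0 : ℕ), (X f).2) b = X b := Function.update_of_ne hbf _ _
  have hg1 := hc g
  have key := M.n3_tags hga hgb hgf hab haf hbf hN (by rw [eg]; exact hc g) (by rw [eg]; omega) (by rw [ea]; exact hc a)
    (by rw [eb]; exact hc b) (by rw [Function.update_self])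
  rwa [ea, eb] at key

/-- **no odd fully charged `P`-cell below ten** (PROVED, h-uniform). -/
theorem no_oddP_below_ten (M : LineModel h vN vP) (hh : h < 10) {X : ACell} (hodd : AOddFC X) : ¬ vP X := by
  intro hX
  obtain ⟨hc, hpar⟩ := hodd
  have e1 := M.fcP_tags_const_below_ten hh hX hc 1 0
  have e2 := M.fcP_tags_const_below_ten hh hX hc 2 0
  have e3 := M.fcP_tags_const_below_ten hh hX hc 3 0
  rw [e1, e2, e3] at hpar
  omega

/-- below twelve the letters of a fully charged `P`-cell have charge `≤ 2` … -/
theorem fcP_charge_le_two (M : LineModel h vN vP) (hh : h < 12) {X : ACell} (hX : vP X) (hc : ∀ f, 1 ≤ (X f).1) (f : Fin 4) :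
    (X f).1 ≤ 2 := by
  have := M.fcP_gap_three hX hc f
  omega

/-- … and the tags away from a charge-2 letter coincide. -/
theorem fcP_tags_around_two (M : LineModel h vN vP) (hh : h < 12) {X : ACell} (hX : vP X) (hc : ∀ f, 1 ≤ (X f).1) {g : Fin 4}
    (hg : 2 ≤ (X g).1) {a b : Fin 4} (hga : g ≠ a) (hgb : g ≠ b) : (X a).2 = (X b).2 := by
  by_cases hab : a = b
  · rw [hab]
  exact M.fcP_three_tags hX hc hga hgb hab (by omega)

/-- **THE SHAPE OF AN ODD FC `P`-CELL BELOW TWELVE** (PROVED): a unit cell, or exactly one charge-2 letter next to three equally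
tagged unit letters. -/
theorem oddP_shape_below_twelve (M : LineModel h vN vP) (hh : h < 12) {X : ACell} (hodd : AOddFC X) (hX : vP X) :
    (∀ f, (X f).1 = 1) ∨
      (∃ g, (X g).1 = 2 ∧ (∀ i, i ≠ g → (X i).1 = 1) ∧ (∀ i j, i ≠ g → j ≠ g → (X i).2 = (X j).2)) := by
  obtain ⟨hc, hpar⟩ := hodd
  by_cases hall : ∀ f, (X f).1 = 1
  · exact Or.inl hall
  right
  push Not at hall
  obtain ⟨g, hg⟩ := hall
  have hg2 : (X g).1 = 2 := by
    have := M.fcP_charge_le_two hh hX hc g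
    have := hc g
    omega
  refine ⟨g, hg2, fun i hig => ?_, fun i j hig hjg => M.fcP_tags_around_two hh hX hc (le_of_eq hg2.symm) (Ne.symm hig) (Ne.symm hjg)⟩
  by_contra hne
  have hi2 : 2 ≤ (X i).1 := by
    have := hc i
    omega
  have tg : ∀ a b, g ≠ a → g ≠ b → (X a).2 = (X b).2 := fun a b ha hb => M.fcP_tags_around_two hh hX hc (le_of_eq hg2.symm) ha hb
  have ti : ∀ a b, i ≠ a → i ≠ b → (X a).2 = (X b).2 := fun a b ha hb => M.fcP_tags_around_two hh hX hc hi2 ha hb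
  have allg : ∀ a, (X a).2 = (X g).2 := by
    intro a
    by_cases hai : a = i
    · rw [hai]
      obtain ⟨b, hbg, hbi⟩ := exists_third g i
      rw [tg i b (Ne.symm hig) hbg.symm]
      exact ti b g hbi.symm hig
    · exact ti a g (fun e => hai e.symm) hig
  rw [allg 0, allg 1, allg 2, allg 3] at hpar
  omega

end LineModel

/-- **NO ODD FC BELOW TEN, abstractly** (PROVED, h-uniform). -/
theorem abstractOddFree_of_lt_ten {h : ℤ} (hh : h < 10) : AbstractOddFree h :=
  fun _ _ M _ hodd => ⟨M.no_oddN_below_twelve (by omega) hodd, M.no_oddP_below_ten hh hodd⟩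

/-- **`(OL_h)` FOR EVERY `h < 10` (PROVED, sorry-free, uniformly in `h`)**: no `G₁`-closed RULE-D∕`X+` design supported on two adjacent
LINE alphabets of height `< 10` has an odd fully charged cell.  This puts the `(OL₈)`, `(OL₉)` rows of the census (formerly MACHINE in the crux
workfile's census: `oddline.py 8 G1` UNSAT, LRAT-checked) into the kernel.  `h = 10, 11` are NOT proved in this module: they are proved in the crux workfile `Cruxes/BlochSeedDiscOne/LinePhaseRigidity.lean`
v1.9 Part J (`oddFCFreeLine_of_lt_twelve`), whose tree port is the later chain module `…Nucleus2`. -/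
theorem oddFCFreeLine_of_lt_ten {h : ℤ} (hh : h < 10) : OddFCFreeLine h :=
  oddFCFreeLine_of_abstract (abstractOddFree_of_lt_ten hh)

/-- **no odd fully charged `N`-cell below twelve**, design form (PROVED). -/
theorem no_odd_fcN_below_twelve {h : ℤ} (hh : h < 12) {C : MConfig} (hC : LSupport h C) (hG : C.G1Closed) (hD : RuleDMu4Closed C)
    (hX : XPlusClosed C) {Z : MCell} (hZ : Z ∈ C.lower) (hFC : FCc Z) : ¬ OddPat Z.pat := by
  have hM := lineModel_of_config hC hG hD hX
  obtain ⟨X, rfl⟩ := exists_realize (fun f => hC.1 _ hZ f)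
  intro hodd
  exact hM.no_oddN_below_twelve hh (aOddFC_of_realize hFC hodd) hZ

/-- **THE UNIT NUCLEUS**: no abstract LINE model at height `h` makes present an odd FC `P`-cell which is a unit cell or has exactly one
charge-2 letter next to three equally tagged unit letters.  At `h = 10` this is ALL that is left of the odd-freeness check
(`abstractOddFree_of_unitNucleus`).  STATUS: in THIS module a typed statement (definition with body) that nothing here proves; it is proved for every
`h < 12` in the crux workfile `Cruxes/BlochSeedDiscOne/LinePhaseRigidity.lean` v1.9 Part J (`abstractOddUnitNucleusFree_of_lt_twelve`, tree port = the later chain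
module `…Nucleus2`) and fails at `h = 12` (workfile census). -/
def AbstractOddUnitNucleusFree (h : ℤ) : Prop :=
  ∀ vN vP : ACell → Prop, LineModel h vN vP → ∀ X : ACell, AOddFC X →
    ((∀ f, (X f).1 = 1) ∨
      (∃ g, (X g).1 = 2 ∧ (∀ i, i ≠ g → (X i).1 = 1) ∧ (∀ i j, i ≠ g → j ≠ g → (X i).2 = (X j).2))) → ¬ vP X

/-- below twelve, odd-freeness ⇐ unit-nucleus-freeness (PROVED). -/
theorem abstractOddFree_of_unitNucleus {h : ℤ} (hh : h < 12) (hU : AbstractOddUnitNucleusFree h) : AbstractOddFree h :=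
  fun vN vP M X hodd => ⟨M.no_oddN_below_twelve hh hodd, fun hX => hU vN vP M X hodd (M.oddP_shape_below_twelve hh hodd hX) hX⟩

/-- **`OddLineThresholdLaw ⇐` the unit nucleus at ten** (PROVED reduction).  The hypothesis `AbstractOddUnitNucleusFree 10` is NOT discharged in this module: that is
the crux workfile's Part J (`oddLineThresholdLaw_holds`), tree port = the later chain module `…Nucleus2`. -/
theorem oddLineThresholdLaw_of_unitNucleus (hU : AbstractOddUnitNucleusFree 10) : OddLineThresholdLaw :=
  oddLineThresholdLaw_of_abstract (abstractOddFree_of_unitNucleus (by norm_num) hU)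

end Summit.Ventures.HSemireg.Pad4Tower.LinePhaseRigidity
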